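import Literature.NumberTheory.Sieve.BrunTitchmarshLargeSieve
import Literature.NumberTheory.Sieve.SmoothRoughDecomposition
import HarnessLib

/-!
# `z`-rough integers in an interval via Montgomery's arithmetic large sieve: an explicit, range-free bound

Topic `Literature/NumberTheory/Sieve`; a leaf over `ArithmeticLargeSieve.lean` (Montgomery's arithmetic large sieve
`card_filter_mul_montgomeryL_le`: a set of integers in `(M, M+N]` avoiding `ω(p)` classes modulo each prime `p ≤ X` has at
most `(N − 1 + X²)/L(X)` elements) and `BrunTitchmarshLargeSieve.lean` (`harmonic_le_sum_squarefree_prod_inv`: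
`L(X) ≥ ∑_{m ≤ X} 1/m` for ONE excluded class per prime). Everything here is PROVED; no definition, no named fact.

The integers of `(M, M+N]` free of prime factors `≤ X` avoid the single class `0 (mod p)` for every prime `p ≤ X`, so

* `card_Ioc_filter_forall_prime_not_dvd_le` — **for all `M, N` and every `X ≥ 2`:
  `#{M < n ≤ M+N : p ∤ n for all primes p ≤ X} ≤ (N − 1 + X²)/log X`**;
* `card_roughIcc_le_largeSieve` — the same for the tree's finset of rough numbers
  `roughIcc (X+1) t = {1 ≤ b ≤ t : p ∣ b ⇒ p > X}` (`SmoothRoughDecomposition.lean`): `#roughIcc (X+1) t ≤ (t − 1 + X²)/log X`;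
* `log_le_montgomeryL_singleton_zero` — the lower bound `log X ≤ L(X)` for one excluded class (`J p = {0}`), made public
  (inside `BrunTitchmarshLargeSieve.lean` it is an inline step of `card_primes_Ioc_le_largeSieve`).

This is the case "`ω(p) = 1`, class `0`" of Bateman–Diamond, *Analytic Number Theory*, Thm 12.9 (Montgomery's sieve) with
the estimate `L(X) ≥ log X` of their proof of Thm 13.3 [cite: BatemanDiamond2004, Thm 12.9 and Thm 13.3 (proof), §13.2 p. 315];
the bound itself — `Φ`-type counts of rough numbers are `≪ N/log X` uniformly, with the large-sieve constant — is [folklore]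
(cf. Montgomery 1978 [cite: Montgomery1978, p. 561]). Relation to the tree: `RoughNumbersInProgressions.card_roughAP_le`
gives `K (y/(φ(q) log z) + z¹⁰)` with an unspecified absolute `K` from the beta-sieve (also for progressions);
`RoughNumbersBuchstab.lean` gives the ASYMPTOTIC `Φ(x,y) = (xω(u) − y)/log y + O(x/log² y)` in the ranges `y ≤ x ≤ y^k`;
the present bound is explicit, uniform in all ranges, and needs no lower bound on `N` — the shape used by Chebyshev-type
census arguments over sifted moduli (e.g. `Summits/…/SiftedVarianceCensus`).
-/

noncomputable section

open Finset Real

namespace Literature.NumberTheory.Sieve.ArithmeticLargeSieve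

/-- `log X ≤ ∑_{m ≤ X} 1/m` (Mathlib's `log_add_one_le_harmonic`, in the `Finset.Icc` currency of this file; private
plumbing, as in `BrunTitchmarshLargeSieve.lean`). [folklore] -/
private theorem log_le_sum_Icc_one_div (X : ℕ) : Real.log X ≤ ∑ m ∈ Icc 1 X, (1 : ℝ) / m := by
  rcases Nat.eq_zero_or_pos X with hX | hX
  · subst hX; simp
  have h1 : Real.log X ≤ Real.log ((X + 1 : ℕ) : ℝ) :=
    Real.log_le_log (by exact_mod_cast hX) (by push_cast; linarith)
  have h2 := log_add_one_le_harmonic X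
  have h3 : ((harmonic X : ℚ) : ℝ) = ∑ m ∈ Icc 1 X, (1 : ℝ) / m := by
    rw [harmonic_eq_sum_Icc]
    push_cast
    refine sum_congr rfl fun m _ => ?_
    rw [one_div]
  linarith [h3 ▸ h2]

/-- **`log X ≤ L(X)` for one excluded class per prime** (`J p = {0}`): Montgomery's
`L(X) = ∑_{ℓ ≤ X} μ²(ℓ) ∏_{p ∣ ℓ} ω(p)/(p − ω(p))` with `ω ≡ 1` is `∑_{ℓ ≤ X} μ²(ℓ)/φ(ℓ) ≥ ∑_{m ≤ X} 1/m ≥ log X`.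
[cite: BatemanDiamond2004, Thm 13.3 (proof), §13.2 p. 315] -/
theorem log_le_montgomeryL_singleton_zero (X : ℕ) : Real.log X ≤ montgomeryL (fun _ => ({0} : Finset ℕ)) X := by
  rw [montgomeryL_eq_sum_montgomeryWeight]
  refine (log_le_sum_Icc_one_div X).trans ((harmonic_le_sum_squarefree_prod_inv X).trans (le_of_eq ?_))
  refine sum_congr rfl fun ℓ _ => ?_
  unfold montgomeryWeight
  refine prod_congr rfl fun p _ => ?_
  simp only [card_singleton, Nat.cast_one]

open Classical in
/-- **Rough numbers in an interval via the large sieve**: for all `M, N` and every `X ≥ 2`,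
`#{M < n ≤ M + N : no prime p ≤ X divides n} ≤ (N − 1 + X²)/log X`.
Proof: such `n` avoid the class `0 (mod p)` for every prime `p ≤ X`; Montgomery's arithmetic large sieve
(`card_filter_mul_montgomeryL_le`, one class per prime) bounds their number by `(N − 1 + X²)/L(X)`, and `L(X) ≥ log X`.
[cite: BatemanDiamond2004, Thm 12.9, §12.5 p. 302] -/
theorem card_Ioc_filter_forall_prime_not_dvd_le (M N X : ℕ) (hX : 2 ≤ X) :
    ((((Ioc M (M + N)).filter (fun n => ∀ p : ℕ, p.Prime → p ≤ X → ¬ p ∣ n)).card : ℕ) : ℝ) ≤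
      ((N : ℝ) - 1 + (X : ℝ) ^ 2) / Real.log X := by
  set J : ℕ → Finset ℕ := fun _ => {0} with hJ
  have hJp : ∀ p : ℕ, p.Prime → p ≤ X → J p ⊆ range p ∧ (J p).card < p := by
    intro p hp _
    refine ⟨?_, ?_⟩
    · intro j hj; simp only [hJ, mem_singleton] at hj; subst hj; exact mem_range.mpr hp.pos
    · simp only [hJ, card_singleton]; exact hp.one_lt
  -- the rough integers lie in the sifted set of the large sieve
  set S := (Ioc M (M + N)).filter (fun n => ∀ p : ℕ, p.Prime → p ≤ X → n % p ∉ J p) with hS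
  have hsub : (Ioc M (M + N)).filter (fun n => ∀ p : ℕ, p.Prime → p ≤ X → ¬ p ∣ n) ⊆ S := by
    intro n hn
    simp only [hS, mem_filter] at hn ⊢
    refine ⟨hn.1, fun p hp hpX => ?_⟩
    simp only [hJ, mem_singleton]
    exact fun h0 => hn.2 p hp hpX (Nat.dvd_of_mod_eq_zero h0)
  have hLS := card_filter_mul_montgomeryL_le M N X (by omega) J hJp
  have hL : Real.log X ≤ montgomeryL J X := log_le_montgomeryL_singleton_zero X
  have hlog : 0 < Real.log X := Real.log_pos (by exact_mod_cast (by omega : 1 < X))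
  have hS_le : (S.card : ℝ) ≤ ((N : ℝ) - 1 + (X : ℝ) ^ 2) / Real.log X := by
    rw [le_div_iff₀ hlog]
    calc (S.card : ℝ) * Real.log X ≤ (S.card : ℝ) * montgomeryL J X :=
          mul_le_mul_of_nonneg_left hL (Nat.cast_nonneg _)
      _ ≤ (X : ℝ) ^ 2 + N - 1 := hLS
      _ = (N : ℝ) - 1 + (X : ℝ) ^ 2 := by ring
  exact le_trans (by exact_mod_cast card_le_card hsub) hS_le

/-- **The tree's rough-number finset, bounded by the large sieve**: for every `X ≥ 2` and every `t`,
`#roughIcc (X + 1) t = #{1 ≤ b ≤ t : p ∣ b ⇒ p > X} ≤ (t − 1 + X²)/log X` — explicit and uniform in all ranges of `t`, `X`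
(compare the asymptotic `RoughNumbersBuchstab.exists_abs_card_roughIcc_sub_main_le` for `y ≤ x ≤ y^k`); the case `M = 0`,
one excluded class `0 (mod p)`, of Montgomery's sieve. [cite: BatemanDiamond2004, Thm 12.9, §12.5 p. 302] -/
theorem card_roughIcc_le_largeSieve (X t : ℕ) (hX : 2 ≤ X) :
    (((roughIcc (X + 1) t).card : ℕ) : ℝ) ≤ ((t : ℝ) - 1 + (X : ℝ) ^ 2) / Real.log X := by
  classical
  have hsub : roughIcc (X + 1) t ⊆ (Ioc 0 (0 + t)).filter (fun n => ∀ p : ℕ, p.Prime → p ≤ X → ¬ p ∣ n) := by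
    intro b hb
    rw [mem_roughIcc] at hb
    rw [mem_filter, mem_Ioc]
    exact ⟨⟨hb.1.1, by simpa using hb.1.2⟩, fun p hp hpX hpb => by have := hb.2 p hp hpb; omega⟩
  exact le_trans (by exact_mod_cast card_le_card hsub) (card_Ioc_filter_forall_prime_not_dvd_le 0 t X hX)

end Literature.NumberTheory.Sieve.ArithmeticLargeSieve

end
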